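import Summits.QuantumFields.YangMills.Theorems.SwapVirialDeficitSwapMeanActionApriori
import Summits.QuantumFields.YangMills.Theorems.SwapVirialDeficitSwapGluedStiffnessOfTwoSectorStiffness
import HarnessLib

/-!
# ⟨24197⟩ `SwapGluedStiffness` from SHARP TWO-SIDED LAPLACE LAWS OF THE TWO EVEN SECTORS `000`, `001` — the per-sector «sharp-sigma» consumer
# (LEAD ym-line-sfw-p2 g97, free hands; cell ym-idea-1; `--supports stmt-QuantumFields-24197`)

WHY THIS FILE.  The landed consumer ✓`SharpSigma.swapGluedStiffness_of_sharpSwapLaplace` (fcl-p3 g43) wants a two-sided power-rate law for the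
TOTAL trace `log Z^S = 12bL⁴ − (9L⁴−1) log b + C_L ± K L^q b^{−θ}`.  Since `Z^S ∝ Σ_z Ẑ_z` over eight seam sectors and the minus sector `001` is only
`O_L(b^{−1/2})`-small relative to the principal one (fixed `L`), a TOTAL law at precision `b^{−θ}` silently needs the two sectors' one-loop constants
compared across DIFFERENT flat valleys (`e^{C′_L − C_L}` — an `L`-uniform one-loop statement nobody needs).  The per-sector reduction
✓`SwapRing.swapGluedStiffness_of_twoSectorStiffness` (w2 g57) avoids this: it wants, on a window, `(9L⁴ − 3/2 + c)·Ẑ_z(β) ≤ β·Ê_z(β)` for `z = 000`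
and `z = 001` SEPARATELY.  This file supplies exactly those two inequalities from PER-SECTOR two-sided laws
`|log Ẑ_z(b) + e_z(L)·log b − C_z(L)| ≤ K·L^q·b^{−θ}` (`9L⁴ − 1 ≤ e_z(L) ≤ 9L⁴`; predicted `e₀₀₀ = 9L⁴ − 1`, `e₀₀₁ = 9L⁴ − 1/2`), each with ITS OWN
free constant `C_z(L)` — so the Morse–Bott programme (w2 g58 memo, M0–M6) may be run valley by valley and never compares constants across sectors.

* §1 (generic, probability space, bounded measurable `F`): `log_sub_le_step_mul_gibbsMean` — the `h`-step thermodynamic sandwich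
  `log Z(b) − log Z((1+h)b) ≤ h·b·⟨F⟩_b` (convexity of `log Z`; ✓`convexOn_log_integral_exp_mul`); ★ `stiffness_of_twoSided_logLaplace` — a LOWER
  bound `log Z(b) ≥ −e log b + C − E₁` and an UPPER bound `log Z((1+h)b) ≤ −e log((1+h)b) + C + E₂` with the SAME `C` give
  `(e/(1+h) − (E₁+E₂)/h)·Z(b) ≤ b·∫F e^{−bF}` (Jensen/convexity; the secant step `h` must be `≍ 1/e ≍ L⁻⁴`, which is why the Laplace errors must be
  `≤ L⁻⁴/80`, i.e. why a POWER rate with polynomial constants — and a steep enough window — is exactly what is needed, and `o(1)` is not).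
* §2 ★★★ `swapGluedStiffness_of_sharpSectorLaplace` — THE CRUX ⟨24197⟩ BY NAME from the two per-sector sharp laws (`c = 1/4`; window exponent
  `a' = min a (θ/(2(q+4)))`, threshold `max β₀ (max 1 ((3200K)^{2/θ}))`, step `h = 1/(40L⁴)`).

HONEST LABEL: a REDUCTION (proved, sorry-free); the two per-sector sharp laws are crux-level and OPEN (they are the Morse–Bott targets); ⟨24197⟩ ∕ ⟨24194⟩ ∕
⟨24196⟩ ∕ ⟨24497⟩ OPEN; own crux ⟨22884⟩ OPEN (blocked-on ⟨19935⟩); no rung of record or summit is proved; the Yang–Mills mass gap is NOT proved; no summit is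
proved by a line.  THEOREMS ONLY (hypotheses inline; 0 `def`, 0 `sorry`), standard axioms.  References: [cite: Griffiths1964]; [cite: tHooft1979];
[cite: Luscher1983, §2]; [folklore].
-/

set_option autoImplicit false

noncomputable section

open MeasureTheory Set Filter
open scoped BigOperators Topology
open Literature.MathematicalPhysics.QuantumFieldTheory hiding SU2
open Literature.MathematicalPhysics.QuantumLattice

namespace Summit.QuantumFields.YangMills.Theorems.SwapVirialDeficit.SwapRing

open Summit.QuantumFields.YangMills.Theorems.FemtoTransferGap
open Summit.QuantumFields.YangMills.Theorems.VirialFluxGap.RingDeficit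
open Summit.QuantumFields.YangMills.Theorems.PortZD (hasDerivAt_log_integral_exp_mul_of_ae_bound integrable_exp_mul_of_ae_bound)

/-! ## §1 Generic: the `h`-step sandwich and stiffness from a two-sided log-Laplace law -/

section Generic

variable {X : Type*} [MeasurableSpace X] (μ : Measure X) [IsProbabilityMeasure μ] {F : X → ℝ} {M : ℝ}

/-- ★ **`h`-STEP THERMODYNAMIC SANDWICH**: for bounded measurable `F` on a probability space, `b > 0`, `h > 0`:
`log Z(b) − log Z((1+h)b) ≤ h·b·⟨F⟩_b`, `Z(t) = ∫ e^{−tF} dμ`, `⟨F⟩_b = ∫F e^{−bF} ∕ Z(b)` (slope ≤ derivative for the convex `s ↦ log ∫e^{sF}`).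
[cite: Griffiths1964] -/
theorem log_sub_le_step_mul_gibbsMean (hF : Measurable F) (hbd : ∀ x, |F x| ≤ M) {b h : ℝ} (hb : 0 < b) (hh : 0 < h) :
    Real.log (∫ x, Real.exp (-b * F x) ∂μ) - Real.log (∫ x, Real.exp (-((1 + h) * b) * F x) ∂μ) ≤
      h * b * ((∫ x, F x * Real.exp (-b * F x) ∂μ) / ∫ x, Real.exp (-b * F x) ∂μ) := by
  have hgc := convexOn_log_integral_exp_mul μ hF hbd
  have hd := hasDerivAt_log_integral_exp_mul_of_ae_bound (μ := μ) hF.aestronglyMeasurable (ae_of_all _ hbd) (-b)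
  have hlt : -((1 + h) * b) < -b := by nlinarith
  have h1 := hgc.slope_le_deriv (mem_univ (-((1 + h) * b))) (mem_univ (-b)) hlt hd.differentiableAt
  rw [hd.deriv, slope_def_field, show -b - -((1 + h) * b) = h * b by ring, div_le_iff₀ (by positivity)] at h1
  linarith

/-- ★★ **STIFFNESS FROM A TWO-SIDED LOG-LAPLACE LAW WITH A COMMON CONSTANT**: `F` bounded measurable on a probability space, `b > 0`, `0 < h`;
if `log Z(b) ≥ −e·log b + C − E₁` and `log Z((1+h)b) ≤ −e·log((1+h)b) + C + E₂` then `(e/(1+h) − (E₁+E₂)/h)·Z(b) ≤ b·∫ F e^{−bF} dμ`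
(`log(1+h) ≥ h/(1+h)`).  With `e ≍ 9L⁴` the step must be `h ≍ L⁻⁴` to lose `< 1/4`, hence `E₁ + E₂ ≲ L⁻⁴`. [cite: Griffiths1964] -/
theorem stiffness_of_twoSided_logLaplace (hF : Measurable F) (hbd : ∀ x, |F x| ≤ M) {b h e C E₁ E₂ : ℝ} (hb : 0 < b) (hh : 0 < h)
    (he : 0 ≤ e)
    (hlow : -e * Real.log b + C - E₁ ≤ Real.log (∫ x, Real.exp (-b * F x) ∂μ))
    (hup : Real.log (∫ x, Real.exp (-((1 + h) * b) * F x) ∂μ) ≤ -e * Real.log ((1 + h) * b) + C + E₂) :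
    (e / (1 + h) - (E₁ + E₂) / h) * ∫ x, Real.exp (-b * F x) ∂μ ≤ b * ∫ x, F x * Real.exp (-b * F x) ∂μ := by
  have hZpos : 0 < ∫ x, Real.exp (-b * F x) ∂μ :=
    integral_exp_pos (integrable_exp_mul_of_ae_bound hF.aestronglyMeasurable (ae_of_all _ hbd) (-b))
  have hstep := log_sub_le_step_mul_gibbsMean μ hF hbd hb hh
  -- `log((1+h)b) − log b = log(1+h) ≥ h/(1+h)`
  have h1h : 0 < 1 + h := by linarith
  have hlog : Real.log ((1 + h) * b) = Real.log (1 + h) + Real.log b := Real.log_mul h1h.ne' hb.ne'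
  have hlog1 : h / (1 + h) ≤ Real.log (1 + h) := by
    have := Real.one_sub_inv_le_log_of_pos h1h
    have e1 : 1 - (1 + h)⁻¹ = h / (1 + h) := by field_simp; ring
    linarith [e1]
  -- combine: `e·log(1+h) − E₁ − E₂ ≤ h b ⟨F⟩`
  have hcomb : e * Real.log (1 + h) - E₁ - E₂ ≤
      h * b * ((∫ x, F x * Real.exp (-b * F x) ∂μ) / ∫ x, Real.exp (-b * F x) ∂μ) := by
    rw [hlog] at hup
    linarith
  have hmean : e * (h / (1 + h)) - E₁ - E₂ ≤ h * b * ((∫ x, F x * Real.exp (-b * F x) ∂μ) / ∫ x, Real.exp (-b * F x) ∂μ) :=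
    le_trans (by nlinarith [mul_le_mul_of_nonneg_left hlog1 he]) hcomb
  -- divide by `h` and multiply by `Z(b)`
  have hdiv : e / (1 + h) - (E₁ + E₂) / h ≤ b * ((∫ x, F x * Real.exp (-b * F x) ∂μ) / ∫ x, Real.exp (-b * F x) ∂μ) := by
    have e2 : e / (1 + h) - (E₁ + E₂) / h = (e * (h / (1 + h)) - E₁ - E₂) / h := by field_simp; ring
    rw [e2, div_le_iff₀ hh]
    linarith
  have := mul_le_mul_of_nonneg_right hdiv hZpos.le
  rwa [mul_assoc, div_mul_cancel₀ _ hZpos.ne'] at this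

end Generic

/-! ## §2 The crux from per-sector sharp laws -/

variable {L : ℕ} [NeZero L]

/-- The per-sector stiffness at one `β` from the sector's two-sided sharp law at `β` and `(1+h)β`, `h = 1/(40L⁴)`, provided the two errors sum to
`≤ h/40`: `(9L⁴ − 3/2 + 1/4)·Ẑ_z(β) ≤ β·Ê_z(β)`. [cite: Griffiths1964] [cite: tHooft1979] -/
theorem sector_stiffness_of_twoSided (z : Fin 3 → Bool) {β e C E₁ E₂ : ℝ} (hβ : 0 < β)
    (he : 9 * (L : ℝ) ^ 4 - 1 ≤ e) (he' : e ≤ 9 * (L : ℝ) ^ 4)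
    (hlow : -e * Real.log β + C - E₁ ≤ Real.log (∫ P, Real.exp (-(β * swapRingDeficit L z P)) ∂(ringMeasure L)))
    (hup : Real.log (∫ P, Real.exp (-((1 + 1 / (40 * (L : ℝ) ^ 4)) * β * swapRingDeficit L z P)) ∂(ringMeasure L)) ≤
      -e * Real.log ((1 + 1 / (40 * (L : ℝ) ^ 4)) * β) + C + E₂)
    (hE : E₁ + E₂ ≤ 1 / (40 * (40 * (L : ℝ) ^ 4))) :
    (9 * (L : ℝ) ^ 4 - 3 / 2 + 1 / 4) * ∫ P, Real.exp (-(β * swapRingDeficit L z P)) ∂(ringMeasure L) ≤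
      β * ∫ P, swapRingDeficit L z P * Real.exp (-(β * swapRingDeficit L z P)) ∂(ringMeasure L) := by
  haveI := isProbabilityMeasure_ringMeasure (L := L)
  obtain ⟨M, hM⟩ := exists_abs_swapRingDeficit_le (L := L) z
  have hL : (1 : ℝ) ≤ L := by exact_mod_cast NeZero.one_le
  have hL4 : (1 : ℝ) ≤ (L : ℝ) ^ 4 := one_le_pow₀ hL
  set h : ℝ := 1 / (40 * (L : ℝ) ^ 4) with hh_def
  have hh : 0 < h := by rw [hh_def]; positivity
  have hh1 : h ≤ 1 / 40 := by
    rw [hh_def]; exact div_le_div_of_nonneg_left (by norm_num) (by norm_num) (by nlinarith)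
  have he0 : 0 ≤ e := le_trans (by nlinarith) he
  -- rewrite the integrands into the `-b * F` form of §1
  have eZ : (∫ P, Real.exp (-(β * swapRingDeficit L z P)) ∂(ringMeasure L)) =
      ∫ P, Real.exp (-β * swapRingDeficit L z P) ∂(ringMeasure L) := by
    refine integral_congr_ae (ae_of_all _ fun P => ?_); simp only [neg_mul]
  have eE : (∫ P, swapRingDeficit L z P * Real.exp (-(β * swapRingDeficit L z P)) ∂(ringMeasure L)) =
      ∫ P, swapRingDeficit L z P * Real.exp (-β * swapRingDeficit L z P) ∂(ringMeasure L) := by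
    refine integral_congr_ae (ae_of_all _ fun P => ?_); simp only [neg_mul]
  have eZ' : (∫ P, Real.exp (-((1 + 1 / (40 * (L : ℝ) ^ 4)) * β * swapRingDeficit L z P)) ∂(ringMeasure L)) =
      ∫ P, Real.exp (-((1 + h) * β) * swapRingDeficit L z P) ∂(ringMeasure L) := by
    refine integral_congr_ae (ae_of_all _ fun P => ?_); simp only [hh_def, neg_mul]
  rw [eZ] at hlow ⊢; rw [eE]; rw [eZ'] at hup
  have hst := stiffness_of_twoSided_logLaplace (ringMeasure L) (measurable_swapRingDeficit z) hM hβ hh he0 hlow hup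
  have hZ0 : 0 ≤ ∫ P, Real.exp (-β * swapRingDeficit L z P) ∂(ringMeasure L) := integral_nonneg fun _ => (Real.exp_pos _).le
  refine le_trans (mul_le_mul_of_nonneg_right ?_ hZ0) hst
  -- arithmetic: `e/(1+h) ≥ e(1−h) ≥ e − 9/40`, `(E₁+E₂)/h ≤ 1/40`
  have h1 : e * (1 - h) ≤ e / (1 + h) := by
    rw [le_div_iff₀ (by linarith)]; nlinarith [sq_nonneg h]
  have h2 : e * h ≤ 9 / 40 := by
    calc e * h ≤ 9 * (L : ℝ) ^ 4 * h := mul_le_mul_of_nonneg_right he' hh.le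
      _ = 9 / 40 := by rw [hh_def]; field_simp
  have h3 : (E₁ + E₂) / h ≤ 1 / 40 := by
    rw [div_le_iff₀ hh]
    calc E₁ + E₂ ≤ 1 / (40 * (40 * (L : ℝ) ^ 4)) := hE
      _ = 1 / 40 * h := by rw [hh_def]; field_simp
  nlinarith

/-- ★★★ **⟨24197⟩ `SwapGluedStiffness` FROM THE SHARP TWO-SIDED LAPLACE LAWS OF THE TWO EVEN SECTORS**, by name (`c = 1/4`).  Hypothesis: common
window/rate data `a, K, q, θ`, per-sector exponents `9L⁴ − 1 ≤ e_z(L) ≤ 9L⁴` and FREE per-sector constants `C_z(L)` (`z = 000`, `001`) with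
`|log ∫e^{−bF^S_z}dμ_L + e_z(L) log b − C_z(L)| ≤ K L^q b^{−θ}` for `b ≥ β₀`, `L₀ ≤ L ≤ b^a`.  No comparison of `C₀₀₀` with `C₀₀₁` is ever needed.
[cite: tHooft1979] [cite: Luscher1983, §2] [cite: Griffiths1964] -/
theorem swapGluedStiffness_of_sharpSectorLaplace
    (hSharp : ∃ a : ℝ, 0 < a ∧ ∃ K : ℝ, 0 < K ∧ ∃ q : ℝ, 0 ≤ q ∧ ∃ θ : ℝ, 0 < θ ∧ θ ≤ 1 ∧ ∃ e₀ e₁ C₀ C₁ : ℕ → ℝ, ∃ β₀ : ℝ, ∃ L₀ : ℕ,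
      (∀ L : ℕ, L₀ ≤ L → 9 * (L : ℝ) ^ 4 - 1 ≤ e₀ L ∧ e₀ L ≤ 9 * (L : ℝ) ^ 4 ∧ 9 * (L : ℝ) ^ 4 - 1 ≤ e₁ L ∧ e₁ L ≤ 9 * (L : ℝ) ^ 4) ∧
      ∀ b : ℝ, β₀ ≤ b → ∀ (L : ℕ) [NeZero L], L₀ ≤ L → (L : ℝ) ≤ b ^ a →
        |Real.log (∫ P, Real.exp (-(b * swapRingDeficit L (fun _ => false) P)) ∂(ringMeasure L)) - (-(e₀ L) * Real.log b + C₀ L)| ≤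
            K * (L : ℝ) ^ q * b ^ (-θ) ∧
        |Real.log (∫ P, Real.exp (-(b * swapRingDeficit L (fun k => decide (k = 2)) P)) ∂(ringMeasure L)) - (-(e₁ L) * Real.log b + C₁ L)| ≤
            K * (L : ℝ) ^ q * b ^ (-θ)) :
    Summit.QuantumFields.YangMills.Theses.SwapVirialDeficit.SwapGluedStiffness := by
  obtain ⟨a, ha, K, hK, q, hq, θ, hθ, hθ1, e₀, e₁, C₀, C₁, β₀, L₀, hexp, hS⟩ := hSharp
  -- window exponent and threshold
  set a' : ℝ := min a (θ / (2 * (q + 4))) with ha'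
  have ha'pos : 0 < a' := lt_min ha (by positivity)
  set β₁ : ℝ := max β₀ (max 1 ((3200 * K) ^ (2 / θ))) with hβ₁
  refine swapGluedStiffness_of_twoSectorStiffness ⟨a', ha'pos, 1 / 4, by norm_num, β₁, L₀, fun β hβ L _ hL hLβ => ?_⟩
  have hβ₀ : β₀ ≤ β := (le_max_left _ _).trans hβ
  have hβ1 : (1 : ℝ) ≤ β := (le_max_left _ _).trans ((le_max_right _ _).trans hβ)
  have hβK : (3200 * K) ^ (2 / θ) ≤ β := (le_max_right _ _).trans ((le_max_right _ _).trans hβ)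
  have hβpos : 0 < β := lt_of_lt_of_le one_pos hβ1
  have hL1 : (1 : ℝ) ≤ L := by exact_mod_cast NeZero.one_le
  have hL4 : (1 : ℝ) ≤ (L : ℝ) ^ 4 := one_le_pow₀ hL1
  -- the step
  set h : ℝ := 1 / (40 * (L : ℝ) ^ 4) with hh_def
  have hh : 0 < h := by rw [hh_def]; positivity
  have h1h : 1 ≤ 1 + h := by linarith
  have hβ' : β ≤ (1 + h) * β := by nlinarith
  have hβ₀' : β₀ ≤ (1 + h) * β := hβ₀.trans hβ'
  -- windows: `L ≤ β^a` and `L ≤ ((1+h)β)^a`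
  have hLa : (L : ℝ) ≤ β ^ a := hLβ.trans (Real.rpow_le_rpow_of_exponent_le hβ1 (min_le_left _ _))
  have hLa' : (L : ℝ) ≤ ((1 + h) * β) ^ a := hLa.trans (Real.rpow_le_rpow hβpos.le hβ' ha.le)
  -- the error budget: `2 K L^q β^{-θ} ≤ 1/(40·40L⁴)`
  have hLq4 : (L : ℝ) ^ (q + 4) ≤ β ^ (θ / 2) := by
    have h1 : (L : ℝ) ^ (q + 4) ≤ (β ^ a') ^ (q + 4) := Real.rpow_le_rpow (by positivity) hLβ (by positivity)
    have h2 : (β ^ a') ^ (q + 4) = β ^ (a' * (q + 4)) := by rw [← Real.rpow_mul hβpos.le]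
    have h3 : a' * (q + 4) ≤ θ / 2 := by
      have : a' ≤ θ / (2 * (q + 4)) := min_le_right _ _
      have hq4 : 0 < q + 4 := by positivity
      calc a' * (q + 4) ≤ θ / (2 * (q + 4)) * (q + 4) := mul_le_mul_of_nonneg_right this hq4.le
        _ = θ / 2 := by field_simp
    rw [h2] at h1
    exact h1.trans (Real.rpow_le_rpow_of_exponent_le hβ1 h3)
  have hKβ : 3200 * K ≤ β ^ (θ / 2) := by
    have h1 : (3200 * K) ^ (2 / θ) ≤ β := hβK
    have h2 : ((3200 * K) ^ (2 / θ)) ^ (θ / 2) ≤ β ^ (θ / 2) := Real.rpow_le_rpow (by positivity) h1 (by positivity)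
    rwa [← Real.rpow_mul (by positivity), show 2 / θ * (θ / 2) = 1 by field_simp, Real.rpow_one] at h2
  have hbudget : 2 * (K * (L : ℝ) ^ q * β ^ (-θ)) ≤ 1 / (40 * (40 * (L : ℝ) ^ 4)) := by
    -- `3200 K L^{q+4} ≤ β^θ`
    have hprod : 3200 * K * (L : ℝ) ^ (q + 4) ≤ β ^ θ := by
      calc 3200 * K * (L : ℝ) ^ (q + 4) ≤ β ^ (θ / 2) * β ^ (θ / 2) :=
            mul_le_mul hKβ hLq4 (by positivity) (by positivity)
        _ = β ^ θ := by rw [← Real.rpow_add hβpos]; ring_nf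
    have hsplit : (L : ℝ) ^ (q + 4) = (L : ℝ) ^ q * (L : ℝ) ^ 4 := by
      rw [Real.rpow_add (by positivity)]
      congr 1
      exact_mod_cast Real.rpow_natCast (L : ℝ) 4
    rw [hsplit] at hprod
    have hθpos : 0 < β ^ θ := Real.rpow_pos_of_pos hβpos θ
    have hKr : K * (L : ℝ) ^ q * β ^ (-θ) ≤ 1 / (3200 * (L : ℝ) ^ 4) := by
      rw [Real.rpow_neg hβpos.le, ← div_eq_mul_inv, div_le_div_iff₀ hθpos (by positivity)]
      calc K * (L : ℝ) ^ q * (3200 * (L : ℝ) ^ 4) = 3200 * K * ((L : ℝ) ^ q * (L : ℝ) ^ 4) := by ring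
        _ ≤ β ^ θ := hprod
        _ = 1 * β ^ θ := (one_mul _).symm
    have e40 : 1 / (40 * (40 * (L : ℝ) ^ 4)) = 2 * (1 / (3200 * (L : ℝ) ^ 4)) := by
      field_simp; ring
    rw [e40]
    exact mul_le_mul_of_nonneg_left hKr (by norm_num)
  have hrate' : K * (L : ℝ) ^ q * ((1 + h) * β) ^ (-θ) ≤ K * (L : ℝ) ^ q * β ^ (-θ) := by
    refine mul_le_mul_of_nonneg_left ?_ (by positivity)
    exact Real.rpow_le_rpow_of_nonpos hβpos hβ' (by linarith)
  obtain ⟨he₀, he₀', he₁, he₁'⟩ := hexp L hL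
  obtain ⟨h000, h001⟩ := hS β hβ₀ L hL hLa
  obtain ⟨h000', h001'⟩ := hS ((1 + h) * β) hβ₀' L hL hLa'
  have hc : (9 * (L : ℝ) ^ 4 - 3 / 2 + 1 / 4) = 9 * (L : ℝ) ^ 4 - 3 / 2 + 1 / 4 := rfl
  constructor
  · -- sector `000`
    have hlow : -(e₀ L) * Real.log β + C₀ L - K * (L : ℝ) ^ q * β ^ (-θ) ≤
        Real.log (∫ P, Real.exp (-(β * swapRingDeficit L (fun _ => false) P)) ∂(ringMeasure L)) := by
      have := (abs_sub_le_iff.1 h000).2; linarith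
    have hup : Real.log (∫ P, Real.exp (-((1 + 1 / (40 * (L : ℝ) ^ 4)) * β * swapRingDeficit L (fun _ => false) P)) ∂(ringMeasure L)) ≤
        -(e₀ L) * Real.log ((1 + 1 / (40 * (L : ℝ) ^ 4)) * β) + C₀ L + K * (L : ℝ) ^ q * β ^ (-θ) := by
      have h1 := (abs_sub_le_iff.1 h000').1
      have e1 : (fun P => Real.exp (-((1 + 1 / (40 * (L : ℝ) ^ 4)) * β * swapRingDeficit L (fun _ => false) P))) =
          fun P => Real.exp (-((1 + h) * β * swapRingDeficit L (fun _ => false) P)) := by rw [hh_def]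
      rw [e1, ← hh_def]; linarith
    exact sector_stiffness_of_twoSided (fun _ => false) hβpos he₀ he₀' hlow hup (by linarith)
  · -- sector `001`
    have hlow : -(e₁ L) * Real.log β + C₁ L - K * (L : ℝ) ^ q * β ^ (-θ) ≤
        Real.log (∫ P, Real.exp (-(β * swapRingDeficit L (fun k => decide (k = 2)) P)) ∂(ringMeasure L)) := by
      have := (abs_sub_le_iff.1 h001).2; linarith
    have hup : Real.log (∫ P, Real.exp (-((1 + 1 / (40 * (L : ℝ) ^ 4)) * β * swapRingDeficit L (fun k => decide (k = 2)) P)) ∂(ringMeasure L)) ≤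
        -(e₁ L) * Real.log ((1 + 1 / (40 * (L : ℝ) ^ 4)) * β) + C₁ L + K * (L : ℝ) ^ q * β ^ (-θ) := by
      have h1 := (abs_sub_le_iff.1 h001').1
      have e1 : (fun P => Real.exp (-((1 + 1 / (40 * (L : ℝ) ^ 4)) * β * swapRingDeficit L (fun k => decide (k = 2)) P))) =
          fun P => Real.exp (-((1 + h) * β * swapRingDeficit L (fun k => decide (k = 2)) P)) := by rw [hh_def]
      rw [e1, ← hh_def]; linarith
    exact sector_stiffness_of_twoSided (fun k => decide (k = 2)) hβpos he₁ he₁' hlow hup (by linarith)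

end Summit.QuantumFields.YangMills.Theorems.SwapVirialDeficit.SwapRing

end
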